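import Summits.ValiantsHypothesis.ValiantsHypothesis.Theorems.LacunarySymmetroidMatrixDescartesCensusPencilPlaneLaw

/-!
# The pencil-plane law is sharp: 2-nets with exactly `m(K−1)` positive roots at every format

Line `span-rank` of crux `MatrixDescartes` (stmt-18050), stub `stub_pencilPlane_sharp`: for `m ≥ 1`, `K ≥ 2`,
`¬ SpanRootLawAt m K 2 (m(K−1) − 1)`.  Witness (all formats at once): support `d = (0, 1, …, K−1)`, net `⟨1, D⟩` with
`D = diag(1, 2, …, m)`, `p = ∏_{i<K−1} (X − 2(i+1))`, `q = ∏_{i<K−1} (X − (2(i+1)+1))`; then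
`det(p(x)·1 + q(x)·D) = ∏_j (p(x) + (j+1) q(x))`, each factor changes sign on `(2(i+1), 2(i+1)+1)` for every
`i < K − 1` (exactly one negative factor in `q(2i+2) p(2i+3) = ∏_{i'} ((2(i−i'))² − 1)`), and two factors have no
common root (it would be a common root of `p` and `q`, i.e. an even integer equal to an odd one).  Together with
`spanRootLawAt_two` (p589587): the span-rank-2 row of the census is EXACTLY `m(K−1)` at every format.  0 sorry.
-/

set_option linter.dupNamespace false
set_option linter.unusedVariables false
set_option linter.unusedSectionVars false

namespace Summit.ValiantsHypothesis.ValiantsHypothesis.Theorems.LacunarySymmetroidMatrixDescartes.Census.SpanRank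

open Polynomial Matrix Finset
open scoped BigOperators
open Summit.ValiantsHypothesis.ValiantsHypothesis.Theorems.LacunarySymmetroidMatrixDescartes.Census.SignSplit
  (pencil posRootCount)

section Witness

variable (N : ℕ)

/-- `p = ∏_{i<N} (X − 2(i+1))`. -/
noncomputable def pSharp : ℝ[X] := ∏ i : Fin N, (X - C (2 * ((i : ℝ) + 1)))

/-- `q = ∏_{i<N} (X − (2(i+1)+1))`. -/
noncomputable def qSharp : ℝ[X] := ∏ i : Fin N, (X - C (2 * ((i : ℝ) + 1) + 1))

/-- Evaluation of `p`. -/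
theorem eval_pSharp (s : ℝ) : (pSharp N).eval s = ∏ i : Fin N, (s - 2 * ((i : ℝ) + 1)) := by
  simp [pSharp, eval_prod]

/-- Evaluation of `q`. -/
theorem eval_qSharp (s : ℝ) : (qSharp N).eval s = ∏ i : Fin N, (s - (2 * ((i : ℝ) + 1) + 1)) := by
  simp [qSharp, eval_prod]

/-- `natDegree p = N`. -/
theorem natDegree_pSharp : (pSharp N).natDegree = N := by
  rw [pSharp, natDegree_finsetProd_X_sub_C_eq_card, Finset.card_univ, Fintype.card_fin]

/-- `natDegree q = N`. -/
theorem natDegree_qSharp : (qSharp N).natDegree = N := by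
  rw [qSharp, natDegree_finsetProd_X_sub_C_eq_card, Finset.card_univ, Fintype.card_fin]

/-- The common support `d = (0, 1, …, N)`. -/
def dSharp : Fin (N + 1) → ℕ := fun l => (l : ℕ)

/-- Coefficients of `p` on the support. -/
noncomputable def aSharp : Fin (N + 1) → ℝ := fun l => (pSharp N).coeff l

/-- Coefficients of `q` on the support. -/
noncomputable def bSharp : Fin (N + 1) → ℝ := fun l => (qSharp N).coeff l

/-- A polynomial of `natDegree ≤ N` is the `(N+1)`-nomial of its coefficients on `(0, …, N)`. [folklore] -/
theorem knom_coeff_eq (f : ℝ[X]) (hf : f.natDegree < N + 1) :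
    knom (dSharp N) (fun l => f.coeff l) = f := by
  unfold knom dSharp
  rw [Fin.sum_univ_eq_sum_range (fun l => C (f.coeff l) * (X : ℝ[X]) ^ l) (N + 1)]
  conv_rhs => rw [f.as_sum_range' (N + 1) hf]
  simp only [← C_mul_X_pow_eq_monomial]

/-- `p` as a `(N+1)`-nomial on the support. -/
theorem knom_aSharp : knom (dSharp N) (aSharp N) = pSharp N :=
  knom_coeff_eq N (pSharp N) (by rw [natDegree_pSharp]; omega)

/-- `q` as a `(N+1)`-nomial on the support. -/
theorem knom_bSharp : knom (dSharp N) (bSharp N) = qSharp N :=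
  knom_coeff_eq N (qSharp N) (by rw [natDegree_qSharp]; omega)

/-- Distinct naturals are at distance `≥ 1` as reals. -/
theorem one_le_sq_sub_of_ne {i i' : ℕ} (h : i ≠ i') : 1 ≤ ((i : ℝ) - i') ^ 2 := by
  rcases Nat.lt_or_gt_of_ne h with hlt | hgt
  · have : (i : ℝ) + 1 ≤ i' := by exact_mod_cast hlt
    nlinarith
  · have : (i' : ℝ) + 1 ≤ i := by exact_mod_cast hgt
    nlinarith

/-- The sign change: `q(2(i+1)) · p(2(i+1)+1) < 0` (exactly one negative factor). -/
theorem eval_q_mul_eval_p_neg (i : Fin N) :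
    (qSharp N).eval (2 * ((i : ℝ) + 1)) * (pSharp N).eval (2 * ((i : ℝ) + 1) + 1) < 0 := by
  rw [eval_qSharp, eval_pSharp, ← Finset.prod_mul_distrib]
  have hfac : ∀ i' : Fin N, (2 * ((i : ℝ) + 1) - (2 * ((i' : ℝ) + 1) + 1)) * (2 * ((i : ℝ) + 1) + 1 - 2 * ((i' : ℝ) + 1))
      = 4 * (((i : ℕ) : ℝ) - (i' : ℕ)) ^ 2 - 1 := by
    intro i'; ring
  simp_rw [hfac]
  rw [← Finset.mul_prod_erase _ _ (Finset.mem_univ i)]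
  have hi : 4 * (((i : ℕ) : ℝ) - (i : ℕ)) ^ 2 - 1 = -1 := by ring
  rw [hi]
  have hpos : 0 < ∏ i' ∈ (Finset.univ : Finset (Fin N)).erase i, (4 * (((i : ℕ) : ℝ) - (i' : ℕ)) ^ 2 - 1) := by
    apply Finset.prod_pos
    intro i' hi'
    have hne : (i : ℕ) ≠ (i' : ℕ) := fun h => (Finset.mem_erase.1 hi').1 (Fin.ext h).symm
    have := one_le_sq_sub_of_ne hne
    linarith
  linarith

/-- The factor `f_β = p + β q`. -/
noncomputable def fSharp (β : ℝ) : ℝ[X] := pSharp N + C β * qSharp N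

/-- Evaluation of `f_β`. -/
theorem eval_fSharp (β s : ℝ) : (fSharp N β).eval s = (pSharp N).eval s + β * (qSharp N).eval s := by
  simp [fSharp]

/-- `p` vanishes at `2(i+1)`. -/
theorem eval_pSharp_node (i : Fin N) : (pSharp N).eval (2 * ((i : ℝ) + 1)) = 0 := by
  rw [eval_pSharp]
  exact Finset.prod_eq_zero (Finset.mem_univ i) (by ring)

/-- `q` vanishes at `2(i+1)+1`. -/
theorem eval_qSharp_node (i : Fin N) : (qSharp N).eval (2 * ((i : ℝ) + 1) + 1) = 0 := by
  rw [eval_qSharp]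
  exact Finset.prod_eq_zero (Finset.mem_univ i) (by ring)

/-- For `β > 0`, `f_β` has a root in each interval `(2(i+1), 2(i+1)+1)`. [IVT] -/
theorem exists_root_fSharp {β : ℝ} (hβ : 0 < β) (i : Fin N) :
    ∃ r : ℝ, 2 * ((i : ℝ) + 1) < r ∧ r < 2 * ((i : ℝ) + 1) + 1 ∧ (fSharp N β).IsRoot r := by
  have hprod : (fSharp N β).eval (2 * ((i : ℝ) + 1)) * (fSharp N β).eval (2 * ((i : ℝ) + 1) + 1) < 0 := by
    rw [eval_fSharp, eval_fSharp, eval_pSharp_node, eval_qSharp_node, zero_add, mul_zero, add_zero]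
    have := eval_q_mul_eval_p_neg N i
    nlinarith
  have hlt : 2 * ((i : ℝ) + 1) < 2 * ((i : ℝ) + 1) + 1 := by linarith
  have hcont : ContinuousOn (fun x => (fSharp N β).eval x) (Set.Icc (2 * ((i : ℝ) + 1)) (2 * ((i : ℝ) + 1) + 1)) :=
    (fSharp N β).continuous.continuousOn
  rcases mul_neg_iff.1 hprod with ⟨h1, h2⟩ | ⟨h1, h2⟩
  · obtain ⟨r, ⟨hr1, hr2⟩, hr⟩ := intermediate_value_Ioo' hlt.le hcont ⟨h2, h1⟩
    exact ⟨r, hr1, hr2, hr⟩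
  · obtain ⟨r, ⟨hr1, hr2⟩, hr⟩ := intermediate_value_Ioo hlt.le hcont ⟨h1, h2⟩
    exact ⟨r, hr1, hr2, hr⟩

/-- A common root of `p` and `q` does not exist (even ≠ odd). -/
theorem not_common_root (r : ℝ) (hp : (pSharp N).eval r = 0) (hq : (qSharp N).eval r = 0) : False := by
  rw [eval_pSharp, Finset.prod_eq_zero_iff] at hp
  rw [eval_qSharp, Finset.prod_eq_zero_iff] at hq
  obtain ⟨i, _, hi⟩ := hp
  obtain ⟨i', _, hi'⟩ := hq
  have h1 : r = ((2 * (i : ℕ) + 2 : ℕ) : ℝ) := by push_cast; linarith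
  have h2 : r = ((2 * (i' : ℕ) + 3 : ℕ) : ℝ) := by push_cast; linarith
  have h3 : (2 * (i : ℕ) + 2 : ℕ) = 2 * (i' : ℕ) + 3 := by exact_mod_cast h1.symm.trans h2
  omega

end Witness

/-! ## The count -/

section Count

variable (m N : ℕ)

/-- The diagonal net direction `D = diag(1, …, m)`. -/
noncomputable def DSharp : Matrix (Fin m) (Fin m) ℝ := Matrix.diagonal fun j => (j : ℝ) + 1

/-- `det(P·1 + Q·D) = ∏_j (P + (j+1) Q)`. -/
theorem det_one_add_DSharp (P Q : ℝ) :
    Matrix.det (P • (1 : Matrix (Fin m) (Fin m) ℝ) + Q • DSharp m) = ∏ j : Fin m, (P + ((j : ℝ) + 1) * Q) := by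
  have : P • (1 : Matrix (Fin m) (Fin m) ℝ) + Q • DSharp m = Matrix.diagonal fun j : Fin m => P + ((j : ℝ) + 1) * Q := by
    ext i j
    simp only [DSharp, Matrix.add_apply, Matrix.smul_apply, Matrix.one_apply, Matrix.diagonal_apply, smul_eq_mul]
    split_ifs <;> ring
  rw [this, Matrix.det_diagonal]

/-- Evaluation of the witness determinant. -/
theorem eval_netDet_sharp (s : ℝ) :
    (netDet (dSharp N) (aSharp N) (bSharp N) (1 : Matrix (Fin m) (Fin m) ℝ) (DSharp m)).eval s
      = ∏ j : Fin m, (fSharp N ((j : ℝ) + 1)).eval s := by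
  rw [eval_netDet, knom_aSharp, knom_bSharp, det_one_add_DSharp]
  simp only [eval_fSharp]

/-- The witness determinant does not vanish at `0`. -/
theorem eval_netDet_sharp_zero_ne :
    (netDet (dSharp N) (aSharp N) (bSharp N) (1 : Matrix (Fin m) (Fin m) ℝ) (DSharp m)).eval 0 ≠ 0 := by
  rw [eval_netDet_sharp, Finset.prod_ne_zero_iff]
  intro j _
  rw [eval_fSharp]
  have hpq : 0 < (pSharp N).eval 0 * (qSharp N).eval 0 := by
    rw [eval_pSharp, eval_qSharp, ← Finset.prod_mul_distrib]
    apply Finset.prod_pos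
    intro i _
    have : (0 : ℝ) ≤ (i : ℝ) := Nat.cast_nonneg _
    nlinarith
  have hp : (pSharp N).eval 0 ≠ 0 := fun h => by rw [h, zero_mul] at hpq; exact lt_irrefl _ hpq
  have hβ : (0 : ℝ) < (j : ℝ) + 1 := by have : (0 : ℝ) ≤ (j : ℝ) := Nat.cast_nonneg _; linarith
  intro h0
  have h1 : ((pSharp N).eval 0 + ((j : ℝ) + 1) * (qSharp N).eval 0) * (pSharp N).eval 0 = 0 := by rw [h0, zero_mul]
  have h2 : 0 < ((pSharp N).eval 0 + ((j : ℝ) + 1) * (qSharp N).eval 0) * (pSharp N).eval 0 := by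
    have hp2 : 0 < (pSharp N).eval 0 ^ 2 := by positivity
    nlinarith
  linarith

/-- **Sharpness count**: the witness 2-net has at least `m · N` distinct positive roots. [this file] -/
theorem card_posRoots_sharp_ge :
    m * N ≤ (posRoots (dSharp N) (aSharp N) (bSharp N) (1 : Matrix (Fin m) (Fin m) ℝ) (DSharp m)).card := by
  classical
  -- the roots
  have hβ : ∀ j : Fin m, (0 : ℝ) < (j : ℝ) + 1 := fun j => by
    have : (0 : ℝ) ≤ (j : ℝ) := Nat.cast_nonneg _; linarith
  choose r hr₁ hr₂ hr₃ using fun (ji : Fin m × Fin N) => exists_root_fSharp N (hβ ji.1) ji.2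
  have hD : netDet (dSharp N) (aSharp N) (bSharp N) (1 : Matrix (Fin m) (Fin m) ℝ) (DSharp m) ≠ 0 := by
    intro h
    have := eval_netDet_sharp_zero_ne m N
    rw [h, eval_zero] at this
    exact this rfl
  -- membership
  have hmem : ∀ ji, r ji ∈ posRoots (dSharp N) (aSharp N) (bSharp N) (1 : Matrix (Fin m) (Fin m) ℝ) (DSharp m) := by
    intro ji
    rw [mem_posRoots]
    refine ⟨hD, ?_, ?_⟩
    · rw [eval_netDet_sharp]
      exact Finset.prod_eq_zero (Finset.mem_univ ji.1) (hr₃ ji)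
    · have := hr₁ ji
      have : (0 : ℝ) ≤ (ji.2 : ℝ) := Nat.cast_nonneg _
      linarith
  -- injectivity
  have hinj : Function.Injective r := by
    intro ji ji' h
    obtain ⟨j, i⟩ := ji
    obtain ⟨j', i'⟩ := ji'
    have h1 := hr₁ (j, i); have h2 := hr₂ (j, i); have h1' := hr₁ (j', i'); have h2' := hr₂ (j', i')
    simp only at h1 h2 h1' h2'
    rw [h] at h1 h2
    have hii' : i = i' := by
      by_contra hne
      have hne' : (i : ℕ) ≠ (i' : ℕ) := fun e => hne (Fin.ext e)
      have := one_le_sq_sub_of_ne hne'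
      nlinarith
    subst hii'
    have hjj' : j = j' := by
      by_contra hne
      have hroot := hr₃ (j, i); have hroot' := hr₃ (j', i)
      simp only at hroot hroot'
      rw [h] at hroot
      rw [IsRoot.def, eval_fSharp] at hroot hroot'
      have hne' : ((j : ℕ) : ℝ) ≠ ((j' : ℕ) : ℝ) := by
        intro e; exact hne (Fin.ext (by exact_mod_cast e))
      have hq : (qSharp N).eval (r (j', i)) = 0 := by
        have : (((j : ℕ) : ℝ) - (j' : ℕ)) * (qSharp N).eval (r (j', i)) = 0 := by linarith
        rcases mul_eq_zero.1 this with h0 | h0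
        · exact absurd (sub_eq_zero.1 h0) hne'
        · exact h0
      have hp : (pSharp N).eval (r (j', i)) = 0 := by rw [hq, mul_zero, add_zero] at hroot'; exact hroot'
      exact not_common_root N _ hp hq
    subst hjj'
    rfl
  calc m * N = (Finset.univ : Finset (Fin m × Fin N)).card := by
        rw [Finset.card_univ, Fintype.card_prod, Fintype.card_fin, Fintype.card_fin]
    _ = ((Finset.univ : Finset (Fin m × Fin N)).image r).card := (Finset.card_image_of_injective _ hinj).symm
    _ ≤ _ := Finset.card_le_card (fun t ht => by
        obtain ⟨ji, _, rfl⟩ := Finset.mem_image.1 ht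
        exact hmem ji)

end Count

/-- **The pencil-plane law is sharp at every format** (line `span-rank`, `stub_pencilPlane_sharp`): for `m ≥ 1` and
`K ≥ 2` some 2-net `K`-letter `m × m` pencil (diagonal, hence symmetric) has `m(K−1)` distinct positive roots.
[this file] -/
theorem not_spanRootLawAt_two_pred (m K : ℕ) (hm : 1 ≤ m) (hK : 2 ≤ K) : ¬ SpanRootLawAt m K 2 (m * (K - 1) - 1) := by
  obtain ⟨N, rfl⟩ : ∃ N, K = N + 1 := ⟨K - 1, by omega⟩
  intro h
  have hN : 1 ≤ N := by omega
  let B : Fin 2 → Matrix (Fin m) (Fin m) ℝ := ![(1 : Matrix (Fin m) (Fin m) ℝ), DSharp m]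
  let c : Fin (N + 1) → Fin 2 → ℝ := fun l => ![aSharp N l, bSharp N l]
  have hle := h (dSharp N) B c
  have hS : (fun l => ∑ i, c l i • B i) = (fun l => aSharp N l • (1 : Matrix (Fin m) (Fin m) ℝ) + bSharp N l • DSharp m) := by
    funext l
    simp [B, c, Fin.sum_univ_two]
  rw [hS] at hle
  have hge := card_posRoots_sharp_ge m N
  have heq : (posRoots (dSharp N) (aSharp N) (bSharp N) (1 : Matrix (Fin m) (Fin m) ℝ) (DSharp m)).card
      = posRootCount (dSharp N) (fun l => aSharp N l • (1 : Matrix (Fin m) (Fin m) ℝ) + bSharp N l • DSharp m) := rfl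
  have hmN : 1 ≤ m * N := Nat.one_le_iff_ne_zero.2 (Nat.mul_ne_zero (by omega) (by omega))
  rw [heq] at hge
  simp only [Nat.add_sub_cancel] at hle
  omega

/-- The span-rank-2 row of the census is exact: `SpanRootLawAt m K 2 B ↔ m(K−1) ≤ B` for `m ≥ 1`, `K ≥ 2`.
[this file + `spanRootLawAt_two`] -/
theorem spanRootLawAt_two_iff (m K B : ℕ) (hm : 1 ≤ m) (hK : 2 ≤ K) : SpanRootLawAt m K 2 B ↔ m * (K - 1) ≤ B := by
  constructor
  · intro h
    by_contra hlt
    rw [not_le] at hlt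
    apply not_spanRootLawAt_two_pred m K hm hK
    intro d B' c
    exact (h d B' c).trans (by omega)
  · intro hB d B' c
    exact (spanRootLawAt_two m K d B' c).trans hB

end Summit.ValiantsHypothesis.ValiantsHypothesis.Theorems.LacunarySymmetroidMatrixDescartes.Census.SpanRank
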